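import Summits.KontsevichZagierPeriods.KontsevichZagierPeriods.Theorems.AperySectorThreeTwo.Negative.Kit
import Literature.NumberTheory.Transcendental.BoxCoordinatePowerMap

/-!
# `AperySectorThreeTwo` (route `HurwitzMicroSectors`, stmt-KontsevichZagierPeriods-3873): negative side IV —
# the polar distribution relation is not ONE `m = 2` dilation

Negative-side support for the crux `AperySectorThreeTwo` (cdisprove unit, cycle 2, refuter
`refuter-cdisprove-stmt-KontsevichZagierPeriods-3873-g2-0`, 2026-08-16; running commentary in the
work file `Cruxes/AperySectorThreeTwo/Disproof.lean`, §8.3). The picked line `flattening-dilation`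
realises the polar distribution relation `[box, c/(1−t²)] ~ [box, 7c·t/(1−t²)]` (`h₀ = 7h₁`,
`t = x₀x₁x₂`) by the `m = 2` coordinate dilation `Φ₂ = (xᵢ²)ᵢ` applied to `c/(1−s) = c(1+s)/(1−s²)`
plus two integrand additivities. The natural SHORTENING "the relation IS the `m = 2` dilation, a
single `changeOfVariablesRel` instance with `Φ = Φ₂`" is refuted here at the level of the move's
integrand condition `f x = f' (Φ x)·|det Φ'(x)|` (with `Φ' = coordPowDeriv 2`, the derivative of
`Φ₂`), in both orientations, at the test point `(½,½,½)` (`t = 1/8`): pulling `7c·s/(1−s²)` back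
along `Φ₂` gives `56c·t³/(1−t⁴) ≠ c/(1−t²)` (`448c/4095 ≠ 64c/63`), pulling `c/(1−s²)` back gives
`8c·t/(1−t⁴) ≠ 7c·t/(1−t²)` (`4096c/4095 ≠ 56c/63`). (The same point refutes every `Φₘ`, `m ≥ 1`:
`7m³8^{1−2m}(63/64)/(1−8^{−2m}) < 1`; only `m = 2`, the dilation actually used, is machine-checked.)
Moral for provers: keep the (1b) split `c/(1−s) = [c/(1−s²)] + [c·s/(1−s²)]` around the dilation;
whether some NON-product semialgebraic `Φ` does it in one move is a transport question of the
`cressonViuSos_prop_3_2` type and is not claimed either way.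
-/

noncomputable section

open MeasureTheory Set
open Literature.NumberTheory.Transcendental Literature.ModelTheory.ExponentialFields

namespace Summit.KontsevichZagierPeriods.Theorems.AperySectorThreeTwo.Negative

/-- The test point `(½,½,½)` of the open box. [folklore] -/
theorem half_mem_ubox : (fun _ => (2⁻¹ : ℝ) : Fin 3 → ℝ) ∈ ubox := fun _ => by norm_num

/-- `Φ₂(½,½,½) = (¼,¼,¼)` lies in the open box. [folklore] -/
theorem coordPow_two_half_mem_ubox :
    BoxIntegral.coordPow 2 (fun _ => (2⁻¹ : ℝ) : Fin 3 → ℝ) ∈ ubox :=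
  BoxIntegral.mapsTo_coordPow_box two_ne_zero half_mem_ubox

/-- **Refuted shortening, orientation A.** With source `[box, c/(1−t²)]` and target
`[box, 7c·t/(1−t²)]` (`c ≠ 0`), the `Φ₂`-pull-back identity demanded by `KZ.changeOfVariablesRel`
fails: the distribution relation `h₀ = 7h₁` is not the bare `m = 2` dilation. [folklore] -/
theorem polar_not_dilationTwo_pullback {c : ℚ} (hc : c ≠ 0) (r r' : KZ.IntegralRep 3)
    (hd : r.domain = ubox) (hd' : r'.domain = ubox)
    (hi : EqOn r.integrand (fun x => (c : ℝ) / (1 - (x 0 * x 1 * x 2) ^ 2)) r.domain)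
    (hi' : EqOn r'.integrand
      (fun x => 7 * (c : ℝ) * (x 0 * x 1 * x 2) / (1 - (x 0 * x 1 * x 2) ^ 2)) r'.domain) :
    ¬ ∀ x ∈ r.domain, r.integrand x =
        r'.integrand (BoxIntegral.coordPow 2 x) * |(BoxIntegral.coordPowDeriv 2 x).det| := by
  intro h
  have hxd : (fun _ => (2⁻¹ : ℝ) : Fin 3 → ℝ) ∈ r.domain := by rw [hd]; exact half_mem_ubox
  have hΦ : BoxIntegral.coordPow 2 (fun _ => (2⁻¹ : ℝ) : Fin 3 → ℝ) ∈ r'.domain := by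
    rw [hd']; exact coordPow_two_half_mem_ubox
  have e := h _ hxd
  rw [hi hxd, hi' hΦ, BoxIntegral.abs_det_coordPowDeriv two_ne_zero half_mem_ubox] at e
  simp only [BoxIntegral.coordPow_apply, Fin.prod_univ_three] at e
  norm_num at e
  have hc0 : (c : ℝ) = 0 := by linarith
  exact hc (by exact_mod_cast hc0)

/-- **Refuted shortening, orientation B.** With source `[box, 7c·t/(1−t²)]` and target
`[box, c/(1−t²)]` (`c ≠ 0`), the `Φ₂`-pull-back identity fails as well. [folklore] -/
theorem polar_not_dilationTwo_pushforward {c : ℚ} (hc : c ≠ 0) (r r' : KZ.IntegralRep 3)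
    (hd : r.domain = ubox) (hd' : r'.domain = ubox)
    (hi : EqOn r.integrand (fun x => (c : ℝ) / (1 - (x 0 * x 1 * x 2) ^ 2)) r.domain)
    (hi' : EqOn r'.integrand
      (fun x => 7 * (c : ℝ) * (x 0 * x 1 * x 2) / (1 - (x 0 * x 1 * x 2) ^ 2)) r'.domain) :
    ¬ ∀ x ∈ r'.domain, r'.integrand x =
        r.integrand (BoxIntegral.coordPow 2 x) * |(BoxIntegral.coordPowDeriv 2 x).det| := by
  intro h
  have hxd : (fun _ => (2⁻¹ : ℝ) : Fin 3 → ℝ) ∈ r'.domain := by rw [hd']; exact half_mem_ubox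
  have hΦ : BoxIntegral.coordPow 2 (fun _ => (2⁻¹ : ℝ) : Fin 3 → ℝ) ∈ r.domain := by
    rw [hd]; exact coordPow_two_half_mem_ubox
  have e := h _ hxd
  rw [hi' hxd, hi hΦ, BoxIntegral.abs_det_coordPowDeriv two_ne_zero half_mem_ubox] at e
  simp only [BoxIntegral.coordPow_apply, Fin.prod_univ_three] at e
  norm_num at e
  have hc0 : (c : ℝ) = 0 := by linarith
  exact hc (by exact_mod_cast hc0)

end Summit.KontsevichZagierPeriods.Theorems.AperySectorThreeTwo.Negative

end
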